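import Summits.Ventures.PercRepro.C041TriSharp
import Summits.Ventures.PercRepro.C041BlockMapCoresPure
import Summits.Ventures.PercRepro.C041BlockMapCores5A
import Summits.Ventures.PercRepro.C041BlockMapCores5B

/-!
# ROW C-041 — THE EXACT DICHOTOMY, FILE A: the non-dominated cores `thetaD1`, `thetaD2`, `theta_c5_0`, `theta_c5_1`, `theta_c5_2`, `theta_c5_3`, `theta_c5_4` as whole triangles + bare apart excesses +
tree maps (p6, gen 39; P6-TWOEXIT-LEAN.md §51; GENERATED by lean-drafts/p6/g39/genexc.py from the exact LP of domin5.py)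

The 20 two-exit cores on `≤ 5` vertices that are NOT triangle-dominated (`C041TriDomK4`, `C041TriDomCores5A–D` hold the 18
that are) are nevertheless exact non-negative integer combinations of whole triangles `θ_△`, BARE APART EXCESSES
`apartExcess w w′ = θ_B w θ_B w′ + θ_R w θ_R w′` (`C041TriSharp`) and tree maps (`theta_eq_excess`, identities of bilinear forms
checked by `ring`): this is the precise sense in which they lie «beyond the triangle» — every one needs at least one bare
apart excess, and the apart excess is not a (P)-map (`not_K4v_apartExcess`), so no domination argument reduces their cone
forms to the triangle's.  The diamonds' (P) for relaxed inputs is THEOREM (RELAXED D1 / D2) (gen 38, certificates); their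
CONE forms and those of the 18 five-vertex cores here are the open cases beyond the triangle (§38, §49).
-/

namespace PercRepro

namespace ZoneZ

namespace MultiExit

open TreeClosure RelaxedTriangle

/-- **THE EXCESS IDENTITY OF `thetaD1`**: `1` whole triangles, `1` bare apart excesses, and tree maps. -/
theorem thetaD1_eq_excess (w w' : Vec6) :
    thetaD1 w w' = (1 : ℝ) • (thetaTri w w') + (1 : ℝ) • (apartExcess w w') + (3 : ℝ) • (ellv w * w') + (3 : ℝ) • (w * ellv w') + (2 : ℝ) • (ellv w * ellv w') + (2 : ℝ) • (w * w') := by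
  ext i
  simp only [thetaD1, apartExcess, thetaTri_eq_sum, Pi.add_apply, Pi.mul_apply, Pi.smul_apply, smul_eq_mul, thB,
    thR, ellv, ell, nAdm, kInv]
  fin_cases i <;> simp <;> ring

/-- **THE EXCESS IDENTITY OF `thetaD2`**: `1` whole triangles, `1` bare apart excesses, and tree maps. -/
theorem thetaD2_eq_excess (w w' : Vec6) :
    thetaD2 w w' = (1 : ℝ) • (thetaTri w w') + (1 : ℝ) • (apartExcess w w') + (3 : ℝ) • (ellv (w * w')) + (3 : ℝ) • (ellv w * w') + (2 : ℝ) • (ellv (ellv w * w')) + (2 : ℝ) • (w * w') := by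
  ext i
  simp only [thetaD2, apartExcess, thetaTri_eq_sum, Pi.add_apply, Pi.mul_apply, Pi.smul_apply, smul_eq_mul, thB,
    thR, ellv, ell, nAdm, kInv]
  fin_cases i <;> simp <;> ring

/-- **THE EXCESS IDENTITY OF `theta_c5_0`**: `2` whole triangles, `1` bare apart excesses, and tree maps. -/
theorem theta_c5_0_eq_excess (w w' : Vec6) :
    theta_c5_0 w w' = (2 : ℝ) • (thetaTri w w') + (1 : ℝ) • (thetaTri w (ellv w')) + (1 : ℝ) • (apartExcess w w') + (1 : ℝ) • (w * ellv w') + (3 : ℝ) • (ellv w * ellv w') + (3 : ℝ) • (ellv (w * ellv w')) + (2 : ℝ) • (ellv (w * (nAdm w' • (1 : Vec6)))) := by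
  ext i
  simp only [theta_c5_0, apartExcess, thetaTri_eq_sum, Pi.add_apply, Pi.mul_apply, Pi.smul_apply, Pi.one_apply, smul_eq_mul, thB,
    thR, ellv, ell, nAdm, kInv]
  fin_cases i <;> simp <;> ring

/-- **THE EXCESS IDENTITY OF `theta_c5_1`**: `2` whole triangles, `2` bare apart excesses, and tree maps. -/
theorem theta_c5_1_eq_excess (w w' : Vec6) :
    theta_c5_1 w w' = (2 : ℝ) • (thetaTri w w') + (2 : ℝ) • (apartExcess w w') + (2 : ℝ) • (ellv (w * w')) + (4 : ℝ) • (ellv (ellv w * w')) + (4 : ℝ) • (ellv (w * ellv w')) + (2 : ℝ) • (nAdm (w * w') • (1 : Vec6)) + (3 : ℝ) • (nAdm (w * ellv w') • (1 : Vec6)) := by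
  ext i
  simp only [theta_c5_1, apartExcess, thetaTri_eq_sum, Pi.add_apply, Pi.mul_apply, Pi.smul_apply, Pi.one_apply, smul_eq_mul, thB,
    thR, ellv, ell, nAdm, kInv]
  fin_cases i <;> simp <;> ring

/-- **THE EXCESS IDENTITY OF `theta_c5_2`**: `1` whole triangles, `4` bare apart excesses, and tree maps. -/
theorem theta_c5_2_eq_excess (w w' : Vec6) :
    theta_c5_2 w w' = (1 : ℝ) • (thetaTri w w') + (1 : ℝ) • (thetaTri w (ellv w')) + (1 : ℝ) • (thetaTri (ellv w) w') + (4 : ℝ) • (apartExcess w w') + (1 : ℝ) • (ellv (w * w')) + (1 : ℝ) • (ellv (ellv w * w')) + (1 : ℝ) • (ellv (w * ellv w')) + (2 : ℝ) • (nAdm (w * w') • (1 : Vec6)) + (1 : ℝ) • (nAdm (w * ellv w') • (1 : Vec6)) + (2 : ℝ) • (w * w') := by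
  ext i
  simp only [theta_c5_2, apartExcess, thetaTri_eq_sum, Pi.add_apply, Pi.mul_apply, Pi.smul_apply, Pi.one_apply, smul_eq_mul, thB,
    thR, ellv, ell, nAdm, kInv]
  fin_cases i <;> simp <;> ring

/-- **THE EXCESS IDENTITY OF `theta_c5_3`**: `1` whole triangles, `2` bare apart excesses, and tree maps. -/
theorem theta_c5_3_eq_excess (w w' : Vec6) :
    theta_c5_3 w w' = (1 : ℝ) • (thetaTri w w') + (2 : ℝ) • (apartExcess w w') + (14 : ℝ) • (ellv w * w') + (14 : ℝ) • (w * ellv w') + (12 : ℝ) • (ellv w * ellv w') + (12 : ℝ) • (w * w') := by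
  ext i
  simp only [theta_c5_3, apartExcess, thetaTri_eq_sum, Pi.add_apply, Pi.mul_apply, Pi.smul_apply, smul_eq_mul, thB,
    thR, ellv, ell, nAdm, kInv]
  fin_cases i <;> simp <;> ring

/-- **THE EXCESS IDENTITY OF `theta_c5_4`**: `6` whole triangles, `2` bare apart excesses, and tree maps. -/
theorem theta_c5_4_eq_excess (w w' : Vec6) :
    theta_c5_4 w w' = (6 : ℝ) • (thetaTri w w') + (2 : ℝ) • (apartExcess w w') + (4 : ℝ) • (ellv w * w') + (14 : ℝ) • (w * ellv w') + (7 : ℝ) • (ellv w * ellv w') + (12 : ℝ) • (w * w') := by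
  ext i
  simp only [theta_c5_4, apartExcess, thetaTri_eq_sum, Pi.add_apply, Pi.mul_apply, Pi.smul_apply, smul_eq_mul, thB,
    thR, ellv, ell, nAdm, kInv]
  fin_cases i <;> simp <;> ring

end MultiExit

end ZoneZ

end PercRepro
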